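import Summits.QuantumFields.YangMills.Theorems.UnitScaleTiltProp7TJRowOfColumns
import HarnessLib

/-!
# LIFT-THREAD 2 (★★OWNER RULING №30; namer ★w2-19200 g9 PEN ASSIGNMENT v1 17:22:48Z «px12 g11: T1»; token convention (α)(β)(γ) 17:25:31Z) — T1 door twin of
# ✓`UnitScaleTiltProp7TJRowOfColumns`: the theorems `hTJ_of_hHcol_hq` VERBATIM with the OPAQUE predicate binder
# `(Lift : ∀ (L : ℕ) (i : Idx L), GaugeField (i.1.1.P i.1.2.2) 0 (Matrix.specialUnitaryGroup (Fin 2) ℂ) → Prop)` (first explicit binder) and the antecedent `Lift L i U₀ →` inserted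
# immediately after the last regularity guard (`RegPr … (α L) U₀ →` ∕ `ρ ≤ α L →`) in the N06-derived rows `hHcol` AND in the op-shaped conclusion; proofs = v1's with
# `hLift` introduced and passed through.  Letters of the v1 file are used BY NAME (imported, not restated).

Cell `ym3-torus`, width seat `ym3-torus-px12` (gen 11).  THEOREMS ONLY (0 `def`, 0 `sorry`); `--supports stmt-QuantumFields-19200 --as helper`, count-neutral.  WHY: px12 g11 LOCATE
«STRATUM (c) AND THE 13 N06 ROWS» (19200 evidence n = 49) + ✓p734809 `Prop7PcolImpliesNSPoincare`: the intrinsic `R_S`-rows of the EX display are inhabitable only on the lift locus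
(`U₀` whose top-level parallel sections lift), so the display S43ᴸT2 carries `Lift L i U₀ →` on the 13 print rows and every door between the display and the junction threads it.
HONEST SCOPE: bookkeeping twin; nothing of print asserted beyond the v1 file; no row, stub or crux is proved; YM₃ on T³ = rung R3 — NOT d = 4, NOT infinite volume, NOT a mass gap, NOT Clay.
References: as in ✓`UnitScaleTiltProp7TJRowOfColumns` (T. Bałaban, CMP 99 (1985) 389–434 [Balaban1985BackgroundPropagators]; CMP 102 (1985) 277–309 [Balaban1985Variational]).
-/

set_option autoImplicit false

noncomputable section

open scoped InnerProductSpace ComplexConjugate Matrix.Norms.L2Operator BigOperators Matrix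
open Complex (I)


open Literature.MathematicalPhysics.QuantumFieldTheory.Balaban1983to89
open Literature.MathematicalPhysics.QuantumFieldTheory.Balaban1983to89.T3ContinuumYM3Torus
open Literature.MathematicalPhysics.QuantumFieldTheory.Balaban1983to89.T3Thm1Carrier (Idx)
open T3SectALandauChart (eta eta_pos)
open T3PrintedRegularMinimiser (RegPr)
open B9SectCLatticeCarrier (Bond)
open B9Eq311L2Pairing (WL2)
open B11Eq115Space (NegSize NegSup Space115 JetSup levWeight)
open B11Eq111FrakG (nabla115)
open B11Eq103H1Complex (SiteL2K BondL2K funEquiv funEquiv_symm_apply)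
open B11Eq98CurrentSlot (Jcur norm_Jcur_le)
open B11Eq90V0primeCurrent (flat115 flat115_apply)
open Summit.QuantumFields.YangMills.Theorems.Prop7SectET3Transport (periodsT3 bondEquiv bgOfCfg isUnitaryBg_bgOfCfg)
open Summit.QuantumFields.YangMills.Theorems.Prop7SectET3HilbertLetters (W₂ frobEquiv toL2 toL2B inner_toL2 toL2_symm_apply)
open Summit.QuantumFields.YangMills.Theorems.Prop7SectET3CurvedPropagators (HT Hf H1f Hf_apply H1f_apply)
open Summit.QuantumFields.YangMills.Theorems.Prop7SectET3DeltaPiPInv (DeltaPiSlotP H46P)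
open Summit.QuantumFields.YangMills.Theorems.Prop7SectET3DeltaOne (actionGrad avgHess)
open Summit.QuantumFields.YangMills.Theorems.Prop7SectET3DeltaOnePInv (TJP TJSlotP tjFormP_apply tjSesqP_apply inner_TJP_left TJSlotP_apply)
open Summit.QuantumFields.YangMills.Theorems.Prop7ActionGradCurrent (actionGrad_eq_inner_toL2_Jcur)
open Summit.QuantumFields.YangMills.Theorems.Prop7SectET3Objects (inU2cur_bgOfCfg_of_regPr)
open Summit.QuantumFields.YangMills.Theorems.Prop7HDsolAtRecordOfRows (toL2_symm_funEquiv_symm_apply norm_negSup_equiv_apply_le)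
open Summit.QuantumFields.YangMills.Theorems.Prop7SigmaRowsNorm (c0_mul_sum_norm_sq_le_norm_sq_toL2)

variable {F : T3Family} {n K : ℕ} {h : n ≤ K} {c₀ cB a : ℝ} [Fact (0 < c₀)] [Fact (0 < cB)]

namespace Summit.QuantumFields.YangMills.Theorems.Prop7TJRowOfColumnsLift

open Summit.QuantumFields.YangMills.Theorems.Prop7TJRowOfColumns

/-- ★★★ **THE FAMILY DOOR `hTJ ⟸ hHcol ∧ hq`** — the EX display's operator row `hTJ` (S19ᴸ ✓p688733 :213–215, the sup-row of print's `T_Jᴾ`, [Balaban1985BackgroundPropagators] (3.137)) TOKEN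
FOR TOKEN with `kTJ L := 2·α L·ΘH L·qA L`, from the display's column row `hHcol` VERBATIM (the `ℓ¹`-column of print's `H` (3.126), [B9] Thm 3.12 (3.133) class, N06) and ONE row in
supplier currency, `hq`: the LOCAL column of the averaging Hessian `2C⁽²⁾(U₀) = avgHess U₀` against a one-bond datum, `Σ_y ‖avgHess U₀ X′ (δ_bd·E) y‖ ≤ qA·(L^{K−n})⁻¹·sup‖X′‖·‖E‖`
((3.14)'s `C_j` is local and begins with second-order terms; [Balaban1985Averaging] (157) class).  The current row (28) is discharged inside (✓`norm_actionGrad_le_of_regPr`).  Dimension line: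
`(2∕η²)·(η³α)·(η·ΘH·(L^{K−n})³)·(qA·(L^{K−n})⁻¹) = 2·α·ΘH·qA` since `L^{K−n}·η = 1`.  CONDITIONAL door; nothing of the stub is claimed.
[cite: Balaban1985BackgroundPropagators, (3.137) p.423, (3.127)–(3.128) p.421, (3.126) p.420, (3.133) p.422, (3.14) p.393; Balaban1985Variational, (27)–(28) p.282; Balaban1985Averaging, (157) p.42] -/
theorem hTJ_of_hHcol_hq
    (Lift : ∀ (L : ℕ) (i : Idx L), GaugeField (i.1.1.P i.1.2.2) 0 (Matrix.specialUnitaryGroup (Fin 2) ℂ) → Prop)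
    [hFL : ∀ F : T3Family, Fact (0 < (F.L : ℝ))] [hFη : ∀ (F : T3Family) (k : ℕ), Fact (0 < ((F.L : ℝ)⁻¹) ^ k)]
    (α ΘH qA : ℕ → ℝ) (hα : ∀ L, 1 < L → 0 < α L) (hΘH0 : ∀ L, 1 < L → 0 ≤ ΘH L) (hqA0 : ∀ L, 1 < L → 0 ≤ qA L)
    (c₀ cB : ℕ → ℝ) [hc₀ : ∀ L : ℕ, Fact (0 < c₀ L)] [hcB : ∀ L : ℕ, Fact (0 < cB L)]
    (a : ∀ L : ℕ, Idx L → ℝ)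
    (hHcol : ∀ (L : ℕ), 1 < L → ∀ (i : Idx L) (U₀ : GaugeField (i.1.1.P i.1.2.2) 0 (Matrix.specialUnitaryGroup (Fin 2) ℂ)), RegPr i.1.1 i.1.2.1 i.1.2.2 (α L) U₀ → Lift L i U₀ →
      ∃ hk : Bond 3 (periodsT3 i.1.1 i.1.2.2) → PBond (i.1.1.P i.1.2.1) 0 → ℝ, (∀ b' y, 0 ≤ hk b' y) ∧
        (∀ (y : PBond (i.1.1.P i.1.2.1) 0) (Z : Matrix (Fin 2) (Fin 2) ℂ) (b' : Bond 3 (periodsT3 i.1.1 i.1.2.2)), ‖flat115 ((H1f i.1.1 i.1.2.1 i.1.2.2 i.2.2.le (c₀ L) (cB L) (a L i) (DeltaPiSlotP i.1.1 i.1.2.1 i.1.2.2 i.2.2.le (c₀ L) (cB L) (a L i)) U₀) (Pi.single y Z)) b'‖ ≤ hk b' y * ‖Z‖) ∧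
        (∀ y : PBond (i.1.1.P i.1.2.1) 0, ∑ b' : Bond 3 (periodsT3 i.1.1 i.1.2.2), hk b' y ≤ ΘH L * ((L : ℝ) ^ (i.1.2.2 - i.1.2.1)) ^ 3))
    -- ROW `hq` — THE LOCAL COLUMN OF THE AVERAGING HESSIAN `2C⁽²⁾(U₀)` AGAINST A ONE-BOND DATUM (supplier currency `qA·(L^{K−n})⁻¹`; DISPLAYED; at `U₀ = 1` a finite flat computation)
    (hq : ∀ (L : ℕ), 1 < L → ∀ (i : Idx L) (U₀ : GaugeField (i.1.1.P i.1.2.2) 0 (Matrix.specialUnitaryGroup (Fin 2) ℂ)), RegPr i.1.1 i.1.2.1 i.1.2.2 (α L) U₀ →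
      ∀ (X' : PBond (i.1.1.P i.1.2.2) 0 → Matrix (Fin 2) (Fin 2) ℂ) (s : ℝ) (bd : PBond (i.1.1.P i.1.2.2) 0) (E : Matrix (Fin 2) (Fin 2) ℂ), (∀ b, ‖X' b‖ ≤ s) →
        ∑ y : PBond (i.1.1.P i.1.2.1) 0, ‖avgHess i.1.1 i.1.2.1 i.1.2.2 i.2.2.le U₀ X' (Pi.single bd E) y‖ ≤ qA L * ((L : ℝ) ^ (i.1.2.2 - i.1.2.1))⁻¹ * s * ‖E‖) :
    ∀ (L : ℕ), 1 < L → ∀ (i : Idx L) (U₀ : GaugeField (i.1.1.P i.1.2.2) 0 (Matrix.specialUnitaryGroup (Fin 2) ℂ)), RegPr i.1.1 i.1.2.1 i.1.2.2 (α L) U₀ → Lift L i U₀ →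
      ∀ (X : PBond (i.1.1.P i.1.2.2) 0 → Matrix (Fin 2) (Fin 2) ℂ) (s : ℝ), (∀ bd, ‖X bd‖ ≤ s) →
        ∀ bd : PBond (i.1.1.P i.1.2.2) 0, ‖(toL2 i.1.1 i.1.2.2 (c₀ L)).symm (TJSlotP i.1.1 i.1.2.1 i.1.2.2 i.2.2.le (c₀ L) (cB L) (a L i) U₀ (toL2 i.1.1 i.1.2.2 (c₀ L) X)) bd‖ ≤
          2 * α L * ΘH L * qA L * s := by
  intro L hL i U₀ hU hLift X s hX bd
  obtain ⟨hk, -, hcol, hsum⟩ := hHcol L hL i U₀ hU hLift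
  have hLpos : (0 : ℝ) < L := by exact_mod_cast (zero_lt_one.trans hL)
  have hM : (0 : ℝ) < (L : ℝ) ^ (i.1.2.2 - i.1.2.1) := pow_pos hLpos _
  have hs : 0 ≤ s := (norm_nonneg _).trans (hX bd)
  have hΘ := hΘH0 L hL
  have hqA := hqA0 L hL
  have hrow := tjRow_of_regPr_column (h := i.2.2.le) (c₀ := c₀ L) (cB := cB L) (a := a L i) (hα L hL).le (by positivity : 0 ≤ ΘH L * ((L : ℝ) ^ (i.1.2.2 - i.1.2.1)) ^ 3)
    (by positivity : 0 ≤ qA L * ((L : ℝ) ^ (i.1.2.2 - i.1.2.1))⁻¹) U₀ hU hcol hsum (hq L hL i U₀ hU) X s hX bd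
  have hη : eta i.1.1 i.1.2.1 i.1.2.2 = ((L : ℝ) ^ (i.1.2.2 - i.1.2.1))⁻¹ := by
    have hLi : (i.1.1.L : ℝ) = (L : ℝ) := by exact_mod_cast i.2.1
    show ((i.1.1.L : ℝ)⁻¹) ^ (i.1.2.2 - i.1.2.1) = _
    rw [hLi, inv_pow]
  rw [hη] at hrow
  calc ‖(toL2 i.1.1 i.1.2.2 (c₀ L)).symm (TJSlotP i.1.1 i.1.2.1 i.1.2.2 i.2.2.le (c₀ L) (cB L) (a L i) U₀ (toL2 i.1.1 i.1.2.2 (c₀ L) X)) bd‖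
      ≤ 2 * α L * (ΘH L * ((L : ℝ) ^ (i.1.2.2 - i.1.2.1)) ^ 3) * (qA L * ((L : ℝ) ^ (i.1.2.2 - i.1.2.1))⁻¹) * (((L : ℝ) ^ (i.1.2.2 - i.1.2.1))⁻¹) ^ 2 * s := hrow
    _ = 2 * α L * ΘH L * qA L * s := by field_simp



end Summit.QuantumFields.YangMills.Theorems.Prop7TJRowOfColumnsLift

end
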